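import Summits.QuantumFields.YangMills.Theorems.PoincareLipschitzLeungXinGraphStability
import HarnessLib

/-!
# Crux `HistoryTailL` (stmt-QuantumFields-19936), K2 organ of record `hImproveCoreFlat` (FROZEN v1 bac8eda3) — supplier side, (S)-SLACK:
# THE LEUNG–XIN TWO-SIDED COMPARISON WITH AN ADDITIVE SLACK, AT FINITE DILATION (no limit `t → 0`)

Cell `ym3-torus` (YM ladder rung R3 = continuum SU(2) Yang–Mills on the three-torus — a RUNG, NOT the Clay problem); width seat `ym-ust-19936-w2` gen 12
(HELD draft, 2026-08-29 — offered by name to LEAD w1 g9 ∕ ★w3 g13 ∕ w8 g7; files only on a word).  THEOREMS ONLY, def-free; imports ✓`…LeungXinGraphStability`.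
WHY.  The organ `hImproveCoreFlat` gives ALMOST-minimality `E(u) ≤ E(v) + δ(ρ+1)`, so the stability step (S) of the supplier chain (★w3 BLUEPRINT §2 ∕ w8
Lemma A) must be read at FINITE dilation `t`: the slack `σ` then enters ONCE, undivided — `Σ_b G_b(t) ≤ σ∕t²` — whereas the `t → 0` Hessian form would cost
`≍ √(σ·N_η)` (useless at large boxes).  This file is ✓`sum_hessianForm_nonpos_of_forall_dot_le` with the hypothesis weakened to `… ≤ Σ_b p_b·q_b + σ` and the
conclusion kept at finite `t` (✓`varPt_dot_varPt_add_neg` + ✓`key_identity`; no continuity argument).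
* §1 ★ `sum_bracket_le_of_forall_dot_le_add` — `∀ t ≠ 0`: `Σ_b ρ_b(t)·[k_b − c_b(A_b + B_b + t²A_bB_b)∕(1 + √(1+t²A_b)√(1+t²B_b))] ≤ σ∕t²`.
* §2 `bracket_sub_zero_eq` (the exact identity `G(t) − G(0) = t²∕(S(S+1))·[D·M∕2 + X − (1−c)Y]`), `key_lower`, `sqrt_prod_le`, `one_le_sqrt_prod`,
  `sq_sub_le_four_D`, `X_bounds`, `Y_bounds`, ★★ `abs_bracket_sub_zero_le` (`|G(t) − G(0)| ≤ (3∕2)t²((1−c)(A+B) + (A+B−2k))` — ENERGY∕CAPACITY type, no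
  volume term), `dotProduct_sq_le`, ★★ `sum_hessianForm_le_of_forall_dot_le_add` (the Hessian form for almost-minimisers:
  `Σ_b (2v_b·w_b − c_b(A_b+B_b)) ≤ 2σ∕t² + 3t²Σ_b((1−c_b)(A_b+B_b) + |v_b−w_b|²)` for `0 < |t| ≤ 1` — optimising `t` costs `≍ √(σ·(E_η + Cap_η))`, i.e.
  `≍ ρ√(δΛ₀)` against the cutoff side `≍ ρ` under `hImproveCoreFlat`'s slack `σ ≍ δ(ρ+1)`).
HONEST SCOPE.  Finite-dimensional algebra; nothing of `hImproveCoreFlat`, `HistoryTailL` or a summit statement is proved; YM₃ on T³ is rung R3, NOT Clay.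
[cite: Xin1980, p.609–613; SchoenUhlenbeck1982, §2]
-/

set_option autoImplicit false

open scoped BigOperators
open Finset

namespace Summit.QuantumFields.YangMills.Theorems.PoincareLipschitzLeungXinGraphStabilitySlack

open Summit.QuantumFields.YangMills.Theorems.PoincareLipschitzLeungXinSphereIdentity (varPt_dot_varPt_add_neg)
open Summit.QuantumFields.YangMills.Theorems.PoincareLipschitzLeungXinGraphStability (key_identity)

/-- ★ **TWO-SIDED ALMOST-MINIMALITY AT FINITE DILATION.**  For families `p q v w : ι → ℝ⁴` on a finite set `s` and a slack `σ`: if for EVERY real `t` the varied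
correlations exceed the unvaried ones by at most `σ`, `Σ_{b∈s} γ_{p_b}^{v_b}(t)·γ_{q_b}^{w_b}(t) ≤ Σ_{b∈s} p_b·q_b + σ` (`γ_p^v(t) = (1 + t²|v|²)^{−1∕2}(p + tv)`),
then for every `t ≠ 0`, with `c_b = p_b·q_b`, `k_b = v_b·w_b`, `A_b = |v_b|²`, `B_b = |w_b|²`:
`Σ_b (√(1+t²A_b))⁻¹(√(1+t²B_b))⁻¹·(k_b − c_b(A_b + B_b + t²A_bB_b)∕(1 + √(1+t²A_b)√(1+t²B_b))) ≤ σ∕t²` — the slack enters once, undivided at `t = 1`.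
[cite: Xin1980, p.609–613] -/
theorem sum_bracket_le_of_forall_dot_le_add {ι : Type*} (s : Finset ι) (p q v w : ι → Fin 4 → ℝ) {σ : ℝ}
    (hmin : ∀ t : ℝ, ∑ b ∈ s, dotProduct ((Real.sqrt (1 + t ^ 2 * dotProduct (v b) (v b)))⁻¹ • (p b + t • v b))
        ((Real.sqrt (1 + t ^ 2 * dotProduct (w b) (w b)))⁻¹ • (q b + t • w b)) ≤ (∑ b ∈ s, dotProduct (p b) (q b)) + σ)
    {t : ℝ} (ht : t ≠ 0) :
    ∑ b ∈ s, (Real.sqrt (1 + t ^ 2 * dotProduct (v b) (v b)))⁻¹ * (Real.sqrt (1 + t ^ 2 * dotProduct (w b) (w b)))⁻¹ *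
        (dotProduct (v b) (w b) - dotProduct (p b) (q b) *
          (dotProduct (v b) (v b) + dotProduct (w b) (w b) + t ^ 2 * dotProduct (v b) (v b) * dotProduct (w b) (w b)) /
            (1 + Real.sqrt (1 + t ^ 2 * dotProduct (v b) (v b)) * Real.sqrt (1 + t ^ 2 * dotProduct (w b) (w b)))) ≤ σ / t ^ 2 := by
  have hnn : ∀ z : Fin 4 → ℝ, 0 ≤ dotProduct z z := fun z => by
    show 0 ≤ ∑ i, z i * z i
    exact Finset.sum_nonneg fun i _ => mul_self_nonneg (z i)
  set cc : ι → ℝ := fun b => dotProduct (p b) (q b) with hcc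
  set kk : ι → ℝ := fun b => dotProduct (v b) (w b) with hkk
  set A : ι → ℝ := fun b => dotProduct (v b) (v b) with hA
  set Bq : ι → ℝ := fun b => dotProduct (w b) (w b) with hBq
  have hA0 : ∀ b, 0 ≤ A b := fun b => hnn _
  have hB0 : ∀ b, 0 ≤ Bq b := fun b => hnn _
  -- two-sided almost-minimality ⇒ `Σ_b [(c + t²k)ρ − c] ≤ σ`
  have hsym : ∑ b ∈ s, ((cc b + t ^ 2 * kk b) * ((Real.sqrt (1 + t ^ 2 * A b))⁻¹ * (Real.sqrt (1 + t ^ 2 * Bq b))⁻¹) - cc b) ≤ σ := by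
    have h1 := hmin t
    have h2 := hmin (-t)
    have hid : ∀ b, dotProduct ((Real.sqrt (1 + t ^ 2 * dotProduct (v b) (v b)))⁻¹ • (p b + t • v b))
            ((Real.sqrt (1 + t ^ 2 * dotProduct (w b) (w b)))⁻¹ • (q b + t • w b)) +
          dotProduct ((Real.sqrt (1 + (-t) ^ 2 * dotProduct (v b) (v b)))⁻¹ • (p b + (-t) • v b))
            ((Real.sqrt (1 + (-t) ^ 2 * dotProduct (w b) (w b)))⁻¹ • (q b + (-t) • w b)) =
          2 * (dotProduct (p b) (q b) + t ^ 2 * dotProduct (v b) (w b)) *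
            ((Real.sqrt (1 + t ^ 2 * dotProduct (v b) (v b)))⁻¹ * (Real.sqrt (1 + t ^ 2 * dotProduct (w b) (w b)))⁻¹) :=
      fun b => varPt_dot_varPt_add_neg (p b) (q b) (v b) (w b) t
    have hsum := add_le_add h1 h2
    rw [← Finset.sum_add_distrib] at hsum
    simp only [hid] at hsum
    have : ∑ b ∈ s, ((cc b + t ^ 2 * kk b) * ((Real.sqrt (1 + t ^ 2 * A b))⁻¹ * (Real.sqrt (1 + t ^ 2 * Bq b))⁻¹) - cc b) =
        (∑ b ∈ s, 2 * (dotProduct (p b) (q b) + t ^ 2 * dotProduct (v b) (w b)) *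
            ((Real.sqrt (1 + t ^ 2 * dotProduct (v b) (v b)))⁻¹ * (Real.sqrt (1 + t ^ 2 * dotProduct (w b) (w b)))⁻¹) -
          2 * ∑ b ∈ s, dotProduct (p b) (q b)) / 2 := by
      rw [Finset.mul_sum, ← Finset.sum_sub_distrib, Finset.sum_div]
      refine Finset.sum_congr rfl fun b _ => ?_
      simp only [hcc, hkk, hA, hBq]
      ring
    rw [this, div_le_iff₀ (by norm_num : (0 : ℝ) < 2)]
    linarith
  -- the key identity: `Σ_b [...] = t² · Σ_b G b t`
  have hrw : ∑ b ∈ s, ((cc b + t ^ 2 * kk b) * ((Real.sqrt (1 + t ^ 2 * A b))⁻¹ * (Real.sqrt (1 + t ^ 2 * Bq b))⁻¹) - cc b) =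
      t ^ 2 * ∑ b ∈ s, (Real.sqrt (1 + t ^ 2 * A b))⁻¹ * (Real.sqrt (1 + t ^ 2 * Bq b))⁻¹ *
        (kk b - cc b * (A b + Bq b + t ^ 2 * A b * Bq b) / (1 + Real.sqrt (1 + t ^ 2 * A b) * Real.sqrt (1 + t ^ 2 * Bq b))) := by
    rw [Finset.mul_sum]
    exact Finset.sum_congr rfl fun b _ => key_identity (cc b) (kk b) (A b) (Bq b) t (hA0 b) (hB0 b)
  rw [hrw] at hsym
  have ht2 : 0 < t ^ 2 := by positivity
  rw [le_div_iff₀ ht2]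
  simpa [hcc, hkk, hA, hBq, mul_comm] using hsym


/-! ## §2 The per-bond modulus: the `t → 0` Hessian form survives an additive slack with an ENERGY∕CAPACITY-type error -/

/-- **THE EXACT IDENTITY BEHIND THE MODULUS**: with `S = √((1+t²A)(1+t²B))`, `M = A+B+t²AB`, `D = A+B−2k`:
`G(t) − G(0) = t²∕(S(S+1))·[D·M∕2 + X − (1−c)·Y]`, `X = (A+B)M∕(2(S+1)) − AB`, `Y = (A+B)M(S+2)∕(2(S+1)) − AB` (uses only `S² = 1 + t²M`). [folklore] -/
theorem bracket_sub_zero_eq (c k A B t : ℝ) (hA : 0 ≤ A) (hB : 0 ≤ B) :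
    (Real.sqrt (1 + t ^ 2 * A))⁻¹ * (Real.sqrt (1 + t ^ 2 * B))⁻¹ *
        (k - c * (A + B + t ^ 2 * A * B) / (1 + Real.sqrt (1 + t ^ 2 * A) * Real.sqrt (1 + t ^ 2 * B))) -
      (k - c * (A + B) / 2) =
      t ^ 2 / (Real.sqrt ((1 + t ^ 2 * A) * (1 + t ^ 2 * B)) * (Real.sqrt ((1 + t ^ 2 * A) * (1 + t ^ 2 * B)) + 1)) *
        ((A + B - 2 * k) * (A + B + t ^ 2 * A * B) / 2 +
          ((A + B) * (A + B + t ^ 2 * A * B) / (2 * (Real.sqrt ((1 + t ^ 2 * A) * (1 + t ^ 2 * B)) + 1)) - A * B) -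
          (1 - c) * ((A + B) * (A + B + t ^ 2 * A * B) * ((Real.sqrt ((1 + t ^ 2 * A) * (1 + t ^ 2 * B)) + 2) /
            (2 * (Real.sqrt ((1 + t ^ 2 * A) * (1 + t ^ 2 * B)) + 1))) - A * B)) := by
  have hx : 0 ≤ 1 + t ^ 2 * A := by positivity
  have hy : 0 ≤ 1 + t ^ 2 * B := by positivity
  set sx := Real.sqrt (1 + t ^ 2 * A) with hsx
  set sy := Real.sqrt (1 + t ^ 2 * B) with hsy
  have hS : Real.sqrt ((1 + t ^ 2 * A) * (1 + t ^ 2 * B)) = sx * sy := Real.sqrt_mul hx _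
  rw [hS]
  set S := sx * sy with hSdef
  set M := A + B + t ^ 2 * A * B with hM
  have hsx1 : 1 ≤ sx := by rw [hsx]; exact Real.one_le_sqrt.mpr (by nlinarith)
  have hsy1 : 1 ≤ sy := by rw [hsy]; exact Real.one_le_sqrt.mpr (by nlinarith)
  have hsx0 : 0 < sx := by linarith
  have hsy0 : 0 < sy := by linarith
  have hS1 : 1 ≤ S := by rw [hSdef]; nlinarith
  have hS0 : 0 < S := by linarith
  have hsx2 : sx ^ 2 = 1 + t ^ 2 * A := Real.sq_sqrt hx
  have hsy2 : sy ^ 2 = 1 + t ^ 2 * B := Real.sq_sqrt hy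
  have hR : S ^ 2 - 1 - t ^ 2 * M = 0 := by
    rw [hSdef, hM, mul_pow, hsx2, hsy2]; ring
  -- `Δ := S(S+1)(G t − G 0)`
  have hinv : sx⁻¹ * sy⁻¹ = S⁻¹ := by rw [hSdef, mul_inv]
  have hGt : S * (S + 1) * (sx⁻¹ * sy⁻¹ * (k - c * M / (1 + S))) = (S + 1) * k - c * M := by
    rw [hinv]; field_simp; ring
  have hpoly : 2 * (S + 1) * (((S + 1) * k - c * M) - S * (S + 1) * (k - c * (A + B) / 2)) -
      t ^ 2 * (-(2 * (S + 1) * k * M) - 2 * (S + 1) * c * A * B + c * (A + B) * M * (S + 2)) =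
      (-(2 * k * (S + 1)) + c * (A + B) * (S + 2)) * (S ^ 2 - 1 - t ^ 2 * M) := by
    rw [hM]; ring
  rw [hR, mul_zero, sub_eq_zero] at hpoly
  -- assemble
  have hS1ne : S + 1 ≠ 0 := by linarith
  have h2S1 : 2 * (S + 1) ≠ 0 := by positivity
  rw [show sx⁻¹ * sy⁻¹ * (k - c * (A + B + t ^ 2 * A * B) / (1 + sx * sy)) = sx⁻¹ * sy⁻¹ * (k - c * M / (1 + S)) by rw [hM]]
  have hΔ : sx⁻¹ * sy⁻¹ * (k - c * M / (1 + S)) - (k - c * (A + B) / 2) =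
      (((S + 1) * k - c * M) - S * (S + 1) * (k - c * (A + B) / 2)) / (S * (S + 1)) := by
    rw [← hGt]; field_simp
  rw [hΔ]
  rw [div_mul_eq_mul_div, div_eq_div_iff (by positivity) (by positivity)]
  -- goal: Δ * (S(S+1)) = t² * Br * (S(S+1))  — reduce to hpoly
  have hBr : (A + B - 2 * k) * M / 2 + ((A + B) * M / (2 * (S + 1)) - A * B) -
      (1 - c) * ((A + B) * M * ((S + 2) / (2 * (S + 1))) - A * B) =
      (-(2 * (S + 1) * k * M) - 2 * (S + 1) * c * A * B + c * (A + B) * M * (S + 2)) / (2 * (S + 1)) := by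
    field_simp; ring
  rw [hBr]
  have : ((S + 1) * k - c * M) - S * (S + 1) * (k - c * (A + B) / 2) =
      t ^ 2 * (-(2 * (S + 1) * k * M) - 2 * (S + 1) * c * A * B + c * (A + B) * M * (S + 2)) / (2 * (S + 1)) := by
    rw [eq_div_iff h2S1]; linarith
  rw [this]; ring
/-- `2t²AB ≤ (A+B)(S−1)` for `S = √((1+t²A)(1+t²B))`, `A, B ≥ 0` (i.e. `S ≥ 1 + 2t²AB∕(A+B)`). [folklore] -/
theorem key_lower (A B t : ℝ) (hA : 0 ≤ A) (hB : 0 ≤ B) :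
    2 * t ^ 2 * A * B ≤ (A + B) * (Real.sqrt ((1 + t ^ 2 * A) * (1 + t ^ 2 * B)) - 1) := by
  rcases eq_or_lt_of_le (add_nonneg hA hB) with hAB | hAB
  · have hA0 : A = 0 := by linarith [hAB]
    have hB0 : B = 0 := by linarith
    simp [hA0, hB0]
  · set w : ℝ := 2 * t ^ 2 * A * B / (A + B) with hw
    have hw0 : 0 ≤ w := by rw [hw]; positivity
    have h4 : 4 * A * B ≤ (A + B) ^ 2 := by nlinarith [sq_nonneg (A - B)]
    have hw1 : (A + B) * w = 2 * t ^ 2 * A * B := by rw [hw]; field_simp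
    have hw2 : 2 * w ≤ t ^ 2 * (A + B) := by
      rw [hw, show 2 * (2 * t ^ 2 * A * B / (A + B)) = t ^ 2 * (4 * A * B) / (A + B) by ring, div_le_iff₀ hAB]
      have := mul_le_mul_of_nonneg_left h4 (sq_nonneg t)
      nlinarith
    have hw3 : w ^ 2 ≤ t ^ 4 * A * B := by
      rw [hw, div_pow, div_le_iff₀ (by positivity)]
      have := mul_le_mul_of_nonneg_left h4 (by positivity : 0 ≤ t ^ 4 * A * B)
      nlinarith
    have hsq : (1 + w) ^ 2 ≤ (1 + t ^ 2 * A) * (1 + t ^ 2 * B) := by nlinarith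
    have hle : 1 + w ≤ Real.sqrt ((1 + t ^ 2 * A) * (1 + t ^ 2 * B)) := (Real.le_sqrt (by linarith) (by positivity)).mpr hsq
    have := mul_le_mul_of_nonneg_left hle hAB.le
    nlinarith

/-- `√((1+t²A)(1+t²B)) ≤ 1 + t²(A+B)∕2` (AM–GM). [folklore] -/
theorem sqrt_prod_le (A B t : ℝ) (hA : 0 ≤ A) (hB : 0 ≤ B) :
    Real.sqrt ((1 + t ^ 2 * A) * (1 + t ^ 2 * B)) ≤ 1 + t ^ 2 * (A + B) / 2 := by
  have h0 : 0 ≤ 1 + t ^ 2 * (A + B) / 2 := by positivity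
  have h1 : (1 + t ^ 2 * A) * (1 + t ^ 2 * B) ≤ (1 + t ^ 2 * (A + B) / 2) ^ 2 := by nlinarith [sq_nonneg (A - B), sq_nonneg (t ^ 2)]
  calc Real.sqrt ((1 + t ^ 2 * A) * (1 + t ^ 2 * B)) ≤ Real.sqrt ((1 + t ^ 2 * (A + B) / 2) ^ 2) := Real.sqrt_le_sqrt h1
    _ = 1 + t ^ 2 * (A + B) / 2 := Real.sqrt_sq h0

/-- `1 ≤ √((1+t²A)(1+t²B))` for `A, B ≥ 0`. [folklore] -/
theorem one_le_sqrt_prod (A B t : ℝ) (hA : 0 ≤ A) (hB : 0 ≤ B) : 1 ≤ Real.sqrt ((1 + t ^ 2 * A) * (1 + t ^ 2 * B)) :=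
  Real.one_le_sqrt.mpr (by nlinarith [sq_nonneg t, mul_nonneg (mul_nonneg (sq_nonneg t) hA) (mul_nonneg (sq_nonneg t) hB)])

/-- `(A−B)² ≤ 4(A+B−2k)` for `0 ≤ A, B ≤ 1`, `k² ≤ AB` (the capacity letter `D = |v−w|² ≥ (|v|−|w|)²`). [folklore] -/
theorem sq_sub_le_four_D (A B k : ℝ) (hA : 0 ≤ A) (hA1 : A ≤ 1) (hB : 0 ≤ B) (hB1 : B ≤ 1) (hk : k ^ 2 ≤ A * B) :
    (A - B) ^ 2 ≤ 4 * (A + B - 2 * k) := by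
  -- `8k ≤ W := 4(A+B) − (A−B)²`, `W ≥ 0`, `W² − 64AB = (A−B)²(16 − 8(A+B) + (A−B)²) ≥ 0`
  have hW0 : 0 ≤ 4 * (A + B) - (A - B) ^ 2 := by nlinarith
  have hW : 64 * (A * B) ≤ (4 * (A + B) - (A - B) ^ 2) ^ 2 := by
    have e : (4 * (A + B) - (A - B) ^ 2) ^ 2 - 64 * (A * B) = (A - B) ^ 2 * (16 - 8 * (A + B) + (A - B) ^ 2) := by ring
    have : 0 ≤ (A - B) ^ 2 * (16 - 8 * (A + B) + (A - B) ^ 2) := mul_nonneg (sq_nonneg _) (by nlinarith)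
    linarith
  rcases le_or_gt k 0 with hk0 | hk0
  · nlinarith
  · have h8 : (8 * k) ^ 2 ≤ (4 * (A + B) - (A - B) ^ 2) ^ 2 := by nlinarith
    have h9 : 8 * k ≤ 4 * (A + B) - (A - B) ^ 2 := le_of_sq_le_sq h8 hW0
    linarith
/-- `X`-bounds: `0 ≤ (A+B)M∕(2(S+1)) − AB ≤ (A−B)²∕4 ≤ A+B−2k`. [folklore] -/
theorem X_bounds (A B k t S : ℝ) (hA : 0 ≤ A) (hA1 : A ≤ 1) (hB : 0 ≤ B) (hB1 : B ≤ 1) (hk : k ^ 2 ≤ A * B)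
    (hS1 : 1 ≤ S) (hP : 2 * t ^ 2 * A * B ≤ (A + B) * (S - 1)) (hSu : S ≤ 1 + t ^ 2 * (A + B) / 2) :
    0 ≤ (A + B) * (A + B + t ^ 2 * A * B) / (2 * (S + 1)) - A * B ∧
      (A + B) * (A + B + t ^ 2 * A * B) / (2 * (S + 1)) - A * B ≤ A + B - 2 * k := by
  have hD4 : (A - B) ^ 2 ≤ 4 * (A + B - 2 * k) := sq_sub_le_four_D A B k hA hA1 hB hB1 hk
  have hAB0 : 0 ≤ A * B := mul_nonneg hA hB
  have ht0 : 0 ≤ t ^ 2 := sq_nonneg t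
  refine ⟨?_, ?_⟩
  · rw [sub_nonneg, le_div_iff₀ (by positivity)]
    have h1 : 2 * S * (A * B) ≤ (2 + t ^ 2 * (A + B)) * (A * B) := by
      have := mul_le_mul_of_nonneg_right hSu hAB0; linarith
    nlinarith [sq_nonneg (A - B)]
  · have h1 : (A + B) * (A + B + t ^ 2 * A * B) / (2 * (S + 1)) ≤ (A + B) ^ 2 / 4 := by
      rw [div_le_div_iff₀ (by positivity) (by norm_num)]
      have h3 := mul_le_mul_of_nonneg_left (show 2 * (A + B + t ^ 2 * A * B) ≤ (A + B) * (S + 1) by linarith) (add_nonneg hA hB)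
      nlinarith
    nlinarith

/-- `Y`-bounds: `−(A+B)∕2 ≤ (A+B)M(S+2)∕(2(S+1)) − AB ≤ (9∕4)(A+B)` (`|t| ≤ 1`, `S ≥ 1`). [folklore] -/
theorem Y_bounds (A B t S : ℝ) (hA : 0 ≤ A) (hA1 : A ≤ 1) (hB : 0 ≤ B) (hB1 : B ≤ 1) (ht : t ^ 2 ≤ 1) (hS1 : 1 ≤ S) :
    -((A + B) / 2) ≤ (A + B) * (A + B + t ^ 2 * A * B) * ((S + 2) / (2 * (S + 1))) - A * B ∧
      (A + B) * (A + B + t ^ 2 * A * B) * ((S + 2) / (2 * (S + 1))) - A * B ≤ 9 / 4 * (A + B) := by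
  have hAB0 : 0 ≤ A * B := mul_nonneg hA hB
  have hAB1 : A * B ≤ 1 := by nlinarith
  have ht0 : 0 ≤ t ^ 2 := sq_nonneg t
  have hM0 : 0 ≤ A + B + t ^ 2 * A * B := by positivity
  have hM3 : A + B + t ^ 2 * A * B ≤ 3 := by nlinarith
  have hθ0 : 0 ≤ (S + 2) / (2 * (S + 1)) := by positivity
  have hθ1 : (S + 2) / (2 * (S + 1)) ≤ 3 / 4 := by rw [div_le_iff₀ (by positivity)]; linarith
  have hABle : A * B ≤ (A + B) / 2 := by nlinarith
  have hY0 : 0 ≤ (A + B) * (A + B + t ^ 2 * A * B) * ((S + 2) / (2 * (S + 1))) := by positivity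
  have h1 : (A + B) * (A + B + t ^ 2 * A * B) ≤ (A + B) * 3 := mul_le_mul_of_nonneg_left hM3 (add_nonneg hA hB)
  have h2 := mul_le_mul h1 hθ1 hθ0 (by positivity)
  constructor <;> linarith

-- hb 400000: `abs_bracket_sub_zero_le` runs between 100k and 200k (hb-100k scratch fails inside its `linarith`∕`nlinarith` rows, farm default passes);
-- the 400k line is lane headroom only (RULING №24 (a) ≤ 400k class)
set_option maxHeartbeats 400000 in
/-- ★★ **THE PER-BOND MODULUS IS OF ENERGY∕CAPACITY TYPE**: for `0 ≤ A, B ≤ 1`, `c ≤ 1`, `k² ≤ AB`, `t² ≤ 1`: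
`|G(t) − G(0)| ≤ (3∕2)·t²·((1−c)(A+B) + (A+B−2k))` — no pure-`η` (volume) term: at the flat∕Leung–Xin letters `(1−c) = e_b∕2` is the bond ENERGY and
`A+B−2k = |v−w|²` the bond CAPACITY. [folklore] -/
theorem abs_bracket_sub_zero_le (c k A B t : ℝ) (hA : 0 ≤ A) (hA1 : A ≤ 1) (hB : 0 ≤ B) (hB1 : B ≤ 1) (hc : c ≤ 1)
    (hk : k ^ 2 ≤ A * B) (ht : t ^ 2 ≤ 1) :
    |(Real.sqrt (1 + t ^ 2 * A))⁻¹ * (Real.sqrt (1 + t ^ 2 * B))⁻¹ *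
        (k - c * (A + B + t ^ 2 * A * B) / (1 + Real.sqrt (1 + t ^ 2 * A) * Real.sqrt (1 + t ^ 2 * B))) -
      (k - c * (A + B) / 2)| ≤ 3 / 2 * t ^ 2 * ((1 - c) * (A + B) + (A + B - 2 * k)) := by
  rw [bracket_sub_zero_eq c k A B t hA hB]
  set S := Real.sqrt ((1 + t ^ 2 * A) * (1 + t ^ 2 * B)) with hS
  have hS1 : 1 ≤ S := one_le_sqrt_prod A B t hA hB
  have hP : 2 * t ^ 2 * A * B ≤ (A + B) * (S - 1) := key_lower A B t hA hB
  have hSu : S ≤ 1 + t ^ 2 * (A + B) / 2 := sqrt_prod_le A B t hA hB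
  obtain ⟨hX0, hX1⟩ := X_bounds A B k t S hA hA1 hB hB1 hk hS1 hP hSu
  obtain ⟨hYlo, hYhi⟩ := Y_bounds A B t S hA hA1 hB hB1 ht hS1
  have hD0 : 0 ≤ A + B - 2 * k := le_trans hX0 hX1
  have hAB0 : 0 ≤ A * B := mul_nonneg hA hB
  have ht0 : 0 ≤ t ^ 2 := sq_nonneg t
  have hM3 : A + B + t ^ 2 * A * B ≤ 3 := by nlinarith
  have hc0 : 0 ≤ 1 - c := by linarith
  -- named atoms
  set M : ℝ := A + B + t ^ 2 * A * B with hMdef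
  set θ : ℝ := (S + 2) / (2 * (S + 1)) with hθdef
  set X : ℝ := (A + B) * M / (2 * (S + 1)) - A * B with hXdef
  set D : ℝ := A + B - 2 * k with hDdef
  have hP1 : (1 - c) * ((A + B) * M * θ - A * B) ≤ (1 - c) * (9 / 4 * (A + B)) := mul_le_mul_of_nonneg_left hYhi hc0
  have hP2 : (1 - c) * (-((A + B) / 2)) ≤ (1 - c) * ((A + B) * M * θ - A * B) := mul_le_mul_of_nonneg_left hYlo hc0
  have hDM1 : D * M / 2 ≤ 3 / 2 * D := by
    have := mul_le_mul_of_nonneg_left hM3 hD0; linarith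
  have hDM0 : 0 ≤ D * M / 2 := by positivity
  set P : ℝ := (1 - c) * ((A + B) * M * θ - A * B) with hPdef
  set Q : ℝ := (1 - c) * (A + B) with hQdef
  have hQ0 : 0 ≤ Q := mul_nonneg hc0 (add_nonneg hA hB)
  have e1 : (1 - c) * (9 / 4 * (A + B)) = 9 / 4 * Q := by rw [hQdef]; ring
  have e2 : (1 - c) * (-((A + B) / 2)) = -(Q / 2) := by rw [hQdef]; ring
  have hP1' : P ≤ 9 / 4 * Q := by linarith
  have hP2' : -(Q / 2) ≤ P := by linarith
  have hbr_hi : D * M / 2 + X - P ≤ 3 * (Q + D) := by linarith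
  have hbr_lo : -(3 * (Q + D)) ≤ D * M / 2 + X - P := by linarith
  -- assemble
  have hS0 : 0 < S := by linarith
  have hpre : 0 ≤ t ^ 2 / (S * (S + 1)) := by positivity
  have hSS : 2 ≤ S * (S + 1) := by nlinarith
  have hpre2 : t ^ 2 / (S * (S + 1)) ≤ t ^ 2 / 2 := div_le_div_of_nonneg_left ht0 (by norm_num) hSS
  rw [abs_mul, abs_of_nonneg hpre]
  have habs : |D * M / 2 + X - P| ≤ 3 * (Q + D) := abs_le.mpr ⟨hbr_lo, hbr_hi⟩
  calc t ^ 2 / (S * (S + 1)) * |D * M / 2 + X - P| ≤ t ^ 2 / 2 * (3 * (Q + D)) :=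
        mul_le_mul hpre2 habs (abs_nonneg _) (by positivity)
    _ = 3 / 2 * t ^ 2 * (Q + D) := by ring

/-- Cauchy–Schwarz for `dotProduct` on `ℝ⁴`: `(v·w)² ≤ (v·v)(w·w)`. [folklore] -/
theorem dotProduct_sq_le (v w : Fin 4 → ℝ) : dotProduct v w ^ 2 ≤ dotProduct v v * dotProduct w w := by
  have h := Finset.sum_mul_sq_le_sq_mul_sq Finset.univ v w
  simp only [dotProduct, pow_two] at h ⊢
  exact h

/-- ★★ **THE HESSIAN FORM FOR ALMOST-MINIMISERS.**  Under the slack hypothesis of `sum_bracket_le_of_forall_dot_le_add` and the size rows `p_b·q_b ≤ 1`, `|v_b|² ≤ 1`,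
`|w_b|² ≤ 1` (unit points, cutoff `η ≤ 1`), for every `0 < |t| ≤ 1`:
`Σ_b (2v_b·w_b − (p_b·q_b)(|v_b|² + |w_b|²)) ≤ 2σ∕t² + 3t²·Σ_b ((1 − p_b·q_b)(|v_b|² + |w_b|²) + |v_b − w_b|²)` — ✓`sum_hessianForm_nonpos_of_forall_dot_le`'s
conclusion up to an additive error of ENERGY (`1 − c_b`) plus CAPACITY (`|v_b − w_b|² = A_b + B_b − 2k_b`) type, so optimising `t` costs `≍ √(σ·(E_η + Cap_η))`.
[cite: Xin1980, p.609–613; SchoenUhlenbeck1982, §2] -/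
theorem sum_hessianForm_le_of_forall_dot_le_add {ι : Type*} (s : Finset ι) (p q v w : ι → Fin 4 → ℝ) {σ : ℝ}
    (hmin : ∀ t : ℝ, ∑ b ∈ s, dotProduct ((Real.sqrt (1 + t ^ 2 * dotProduct (v b) (v b)))⁻¹ • (p b + t • v b))
        ((Real.sqrt (1 + t ^ 2 * dotProduct (w b) (w b)))⁻¹ • (q b + t • w b)) ≤ (∑ b ∈ s, dotProduct (p b) (q b)) + σ)
    (hpq : ∀ b ∈ s, dotProduct (p b) (q b) ≤ 1) (hv : ∀ b ∈ s, dotProduct (v b) (v b) ≤ 1) (hw : ∀ b ∈ s, dotProduct (w b) (w b) ≤ 1)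
    {t : ℝ} (ht : t ≠ 0) (ht1 : t ^ 2 ≤ 1) :
    ∑ b ∈ s, (2 * dotProduct (v b) (w b) - dotProduct (p b) (q b) * (dotProduct (v b) (v b) + dotProduct (w b) (w b))) ≤
      2 * σ / t ^ 2 + 3 * t ^ 2 * ∑ b ∈ s, ((1 - dotProduct (p b) (q b)) * (dotProduct (v b) (v b) + dotProduct (w b) (w b)) +
        (dotProduct (v b) (v b) + dotProduct (w b) (w b) - 2 * dotProduct (v b) (w b))) := by
  have hnn : ∀ z : Fin 4 → ℝ, 0 ≤ dotProduct z z := fun z => by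
    show 0 ≤ ∑ i, z i * z i
    exact Finset.sum_nonneg fun i _ => mul_self_nonneg (z i)
  have hfin := sum_bracket_le_of_forall_dot_le_add s p q v w hmin ht
  -- per bond: `G_b(0) ≤ G_b(t) + (3∕2)t²(…)`
  have hper : ∀ b ∈ s, dotProduct (v b) (w b) - dotProduct (p b) (q b) * (dotProduct (v b) (v b) + dotProduct (w b) (w b)) / 2 ≤
      (Real.sqrt (1 + t ^ 2 * dotProduct (v b) (v b)))⁻¹ * (Real.sqrt (1 + t ^ 2 * dotProduct (w b) (w b)))⁻¹ *
        (dotProduct (v b) (w b) - dotProduct (p b) (q b) *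
          (dotProduct (v b) (v b) + dotProduct (w b) (w b) + t ^ 2 * dotProduct (v b) (v b) * dotProduct (w b) (w b)) /
            (1 + Real.sqrt (1 + t ^ 2 * dotProduct (v b) (v b)) * Real.sqrt (1 + t ^ 2 * dotProduct (w b) (w b)))) +
      3 / 2 * t ^ 2 * ((1 - dotProduct (p b) (q b)) * (dotProduct (v b) (v b) + dotProduct (w b) (w b)) +
        (dotProduct (v b) (v b) + dotProduct (w b) (w b) - 2 * dotProduct (v b) (w b))) := by
    intro b hb
    have h := abs_bracket_sub_zero_le (dotProduct (p b) (q b)) (dotProduct (v b) (w b)) (dotProduct (v b) (v b)) (dotProduct (w b) (w b)) t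
      (hnn _) (hv b hb) (hnn _) (hw b hb) (hpq b hb) (dotProduct_sq_le (v b) (w b)) ht1
    have h2 := (abs_le.mp h).1
    linarith
  have hsum := Finset.sum_le_sum hper
  rw [Finset.sum_add_distrib, ← Finset.mul_sum] at hsum
  have ht2 : 0 < t ^ 2 := by positivity
  have e : ∑ b ∈ s, (2 * dotProduct (v b) (w b) - dotProduct (p b) (q b) * (dotProduct (v b) (v b) + dotProduct (w b) (w b))) =
      2 * ∑ b ∈ s, (dotProduct (v b) (w b) - dotProduct (p b) (q b) * (dotProduct (v b) (v b) + dotProduct (w b) (w b)) / 2) := by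
    rw [Finset.mul_sum]; exact Finset.sum_congr rfl fun b _ => by ring
  rw [e]
  have hf' : 2 * (σ / t ^ 2) = 2 * σ / t ^ 2 := by ring
  linarith

end Summit.QuantumFields.YangMills.Theorems.PoincareLipschitzLeungXinGraphStabilitySlack
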